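import Literature.Probability.Percolation.MarkedLoopFanRank
import Literature.Probability.Percolation.MarkedLoopCatalan
import HarnessLib

/-!
# The rotated fans span the tripod-law solution space exactly at five disorders

Topic `Literature/Probability/Percolation`; generic-`k` layer, a rider on `MarkedLoopFanRank.lean` («FAN-RANK-ALL»: for every odd `k = 2l+1 ≥ 5` the
`k` rotated Khristoforov–Smirnov fans `fanSol l s` are LINEARLY INDEPENDENT tripod-law solutions, `le_finrank_solW : k ≤ dim solW k`) and on
`MarkedLoopCatalan.lean` («LINK-CATALAN»: `finrank_solW_eq_catalan : dim solW (2l+1) = C_{l+1}`, `lt_finrank_solW : 3 ≤ l → 2l+1 < dim`).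
THE SHARP STATEMENT: the fans span the solution space iff `k = 5`.

## Content
* `finrank_span_fanSol : dim (span of the k fans) = k` (`l ≥ 2`); ★★★ `span_fanSol_eq_top_iff : span = ⊤ ↔ l = 2` — at five disorders the five
  rotated fans are a basis (the tree's `MarkedLoopTripodBasisFive.fanBasis`, re-derived here from independence + `C_3 = 5`), and from seven
  disorders on they never span (`2l+1 < C_{l+1}`); `span_fanSol_five`, `span_fanSol_ne_top`.

## References
* M. Khristoforov, S. Smirnov, *Percolation and O(1) loop model*, arXiv:2111.15612 (2021), §2 Definition 3, Lemma 4 and Remark 6 (arXiv v1 pp. 4–5: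
  the fan weight `τ^j` at three disorders), §1.2 (p. 2).
-/

namespace Literature.Probability.Percolation.MarkedLoops

section FanSpan

variable {l : ℕ}

/-- the `k` independent fans span a `k`-dimensional subspace (`k = 2l+1 ≥ 5`). [cite: KhristoforovSmirnov2021, §2 Definition 3 and Lemma 4
(arXiv v1 p. 4); Remark 6 (p. 5)] -/
theorem finrank_span_fanSol (hl : 2 ≤ l) : Module.finrank ℂ (Submodule.span ℂ (Set.range (fanSol l))) = 2 * l + 1 := by
  rw [finrank_span_eq_card (linearIndependent_fanSol hl), Fintype.card_fin]

/-- ★ **AT FIVE DISORDERS THE FIVE ROTATED FANS SPAN** (`dim solW 5 = C_3 = 5`; the tree's `fanBasis`, from independence and the count).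
[cite: KhristoforovSmirnov2021, §2 Definition 3 and Lemma 4 (arXiv v1 p. 4); Remark 6 (p. 5)] -/
theorem span_fanSol_five : Submodule.span ℂ (Set.range (fanSol 2)) = ⊤ :=
  (linearIndependent_fanSol (l := 2) le_rfl).span_eq_top_of_card_eq_finrank
    (by rw [Fintype.card_fin, finrank_solW_eq_catalan, catalan_three])

/-- ★ **FROM SEVEN DISORDERS ON THE ROTATED FANS DO NOT SPAN** (`2l+1 < C_{l+1} = dim solW`). [cite: KhristoforovSmirnov2021, §2 Definition 3
and Lemma 4 (arXiv v1 p. 4); Remark 6 (p. 5)] -/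
theorem span_fanSol_ne_top (hl : 3 ≤ l) : Submodule.span ℂ (Set.range (fanSol l)) ≠ ⊤ := by
  intro h
  have h1 := finrank_span_fanSol (l := l) (by omega)
  rw [h, finrank_top] at h1
  have h2 := lt_finrank_solW hl
  omega

/-- ★★★ **THE ROTATED KHRISTOFOROV–SMIRNOV FANS SPAN THE TRIPOD-LAW SOLUTION SPACE IFF `k = 5`** (`k = 2l+1 ≥ 5`): at `k = 5` they are a basis,
for `k ≥ 7` they are `k` independent solutions in a space of dimension `C_{(k+1)/2} > k`. [cite: KhristoforovSmirnov2021, §2 Definition 3 and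
Lemma 4 (arXiv v1 p. 4); Remark 6 (p. 5); §1.2 (p. 2)] -/
theorem span_fanSol_eq_top_iff (hl : 2 ≤ l) : Submodule.span ℂ (Set.range (fanSol l)) = ⊤ ↔ l = 2 := by
  constructor
  · intro h
    by_contra hne
    exact span_fanSol_ne_top (by omega) h
  · rintro rfl
    exact span_fanSol_five

end FanSpan

end Literature.Probability.Percolation.MarkedLoops
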